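import Summits.CriticalPhenomena.PercolationContinuityZ3.Theorems.PercNearOneGluingNoHeavyLowerTailCSHDefs
import Summits.CriticalPhenomena.PercolationContinuityZ3.Theorems.PercNearOneGluingNoHeavyLowerTailHullPortDeletedEdges
import Summits.CriticalPhenomena.PercolationContinuityZ3.Theorems.PercNearOneGluingAdditiveGluingCSHHpart
import Literature.Probability.Percolation.KozmaNitzanSeparatingTriple
import HarnessLib

/-!
# The observer constant of the level-0 conditioned slack hierarchy is ATTAINED (PAPER-2 track (ii): constants of the CSH family)

Support file (`--supports stmt-CriticalPhenomena-4575`), seat `prim-consts-1` (inventory `run/shared/lean/prim/consts/CONSTANTS.md`, rows A6/A11).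
No definitions, no named facts, no sorries.  builds on p205010 (kernel theorem, internal audit signed; external expert review pending).

Level `0` of the hierarchy with empty avoided set — `Cov(f(𝐂_x), 1{x ↔ o}) ≥ p · Cov(f(𝐂_x), 1{x ↔ v})`, `p = P(o ∈ C_v | v ↮ x)`
(`CSH.cshMargin_nil_nonneg`) — is an EQUALITY at the single-pair functional `f = 1{s(x,v) ∈ 𝐂_x}` on EVERY finite weighted graph:
* `CSH.covD_nil_pairOpen_eq` — `covD(f, u) = w_e (1 − w_e) · (μ₀(x ↔ u ∨ v ↔ u) − μ₀(x ↔ u))`, `μ₀` = the law with the pair `e = s(x,v)` off;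
  `CSH.covD_nil_pairOpen_self` — at `u = v` this is `w_e (1 − w_e) · μ₀(v ↮ x)`;
* `CSH.cshMargin_nil_pairOpen_eq_zero` — `cshMargin w x ∅ [] o v f = 0` (`x ≠ v`);
* `CSH.obsConst_nil_not_improvable` — for non-degenerate weights no `p' > p` satisfies the level-0 inequality at `f`: the observer
  constant is best possible in its own data (paper-s3 F2/F5 at `k = 0`, there by exact enumeration on `K₃ … K₆`; here for all graphs).
Method: pin the single pair `e` (`CSH.sum_weight_indicator_mul_comp_sdiff_singleton`, companion of `HullPort.sum_weight_mul_comp_sdiff_singleton`),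
the one-extra-edge reachability lemma `KNSep.reachable_insert_iff`, and algebra.
[cite: VandenbergHaggstromKahn2005, Thm. 1.3 (p. 6) — context only; the identity is ours (cell memos prim-paper-s3 g64/g65, F2/F5)]
-/

noncomputable section

namespace Summit.CriticalPhenomena.PercolationContinuityZ3.Theorems

open MeasureTheory Set Literature.Probability.LatticeModels Literature.Probability.Percolation
open scoped Classical
open BHK2006

namespace CSH

section Weights

variable {ι : Type*} [Fintype ι]

/-- **Pinning one coordinate OPEN**: `Σ_η weight(w) η · 1{e ∈ η} · φ(η ∖ {e}) = w e · Σ_η weight(w₀) η · φ η`, with `w₀ = w` except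
`w₀ e = 0` (given that the coordinate `e` is on, the rest of the configuration has the product law with `e` switched off). [folklore] -/
theorem sum_weight_indicator_mul_comp_sdiff_singleton (w : ι → ℝ) (e : ι) (φ : Set ι → ℝ) :
    ∑ η, weight w η * ((if e ∈ η then (1 : ℝ) else 0) * φ (η \ {e})) =
      w e * ∑ η, weight (fun i => if i = e then 0 else w i) η * φ η := by
  classical
  set w₀ : ι → ℝ := fun i => if i = e then 0 else w i with hw₀
  set R : Set ι → ℝ := fun η => ∏ i ∈ Finset.univ.erase e, (if i ∈ η then w i else 1 - w i) with hR
  have hfac : ∀ η : Set ι, weight w η = (if e ∈ η then w e else 1 - w e) * R η := fun η =>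
    (Finset.mul_prod_erase Finset.univ (fun i => if i ∈ η then w i else 1 - w i) (Finset.mem_univ e)).symm
  have hfac₀ : ∀ η : Set ι, weight w₀ η = (if e ∈ η then 0 else 1) * R η := by
    intro η
    have h := (Finset.mul_prod_erase Finset.univ (fun i => if i ∈ η then w₀ i else 1 - w₀ i)
      (Finset.mem_univ e)).symm
    have hRe : ∏ i ∈ Finset.univ.erase e, (if i ∈ η then w₀ i else 1 - w₀ i) = R η := by
      refine Finset.prod_congr rfl fun i hi => ?_
      have hie : i ≠ e := Finset.ne_of_mem_erase hi
      simp only [hw₀, if_neg hie]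
    rw [hRe] at h
    rw [show w₀ e = 0 by simp only [hw₀, if_true]] at h
    rw [show weight w₀ η = ∏ i, (if i ∈ η then w₀ i else 1 - w₀ i) from rfl, h]
    split_ifs <;> ring
  have hRins : ∀ η : Set ι, R (insert e η) = R η := fun η =>
    Finset.prod_congr rfl fun i hi => by
      have hie : i ≠ e := Finset.ne_of_mem_erase hi
      simp only [Set.mem_insert_iff, hie, false_or]
  rw [← Finset.sum_filter_add_sum_filter_not Finset.univ (fun η : Set ι => e ∈ η), Finset.mul_sum,
    ← Finset.sum_filter_add_sum_filter_not Finset.univ (fun η : Set ι => e ∈ η)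
      (fun η => w e * (weight w₀ η * φ η))]
  have hzeroL : ∑ η ∈ Finset.univ.filter (fun η : Set ι => ¬ e ∈ η),
      weight w η * ((if e ∈ η then (1 : ℝ) else 0) * φ (η \ {e})) = 0 := by
    refine Finset.sum_eq_zero fun η hη => ?_
    have he : e ∉ η := (Finset.mem_filter.1 hη).2
    rw [if_neg he]; ring
  have hzeroR : ∑ η ∈ Finset.univ.filter (fun η : Set ι => e ∈ η), w e * (weight w₀ η * φ η) = 0 := by
    refine Finset.sum_eq_zero fun η hη => ?_
    have he : e ∈ η := (Finset.mem_filter.1 hη).2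
    rw [hfac₀ η, if_pos he]; ring
  have hreidx : ∑ η ∈ Finset.univ.filter (fun η : Set ι => e ∈ η),
      weight w η * ((if e ∈ η then (1 : ℝ) else 0) * φ (η \ {e})) =
      ∑ η ∈ Finset.univ.filter (fun η : Set ι => ¬ e ∈ η), weight w (insert e η) * φ η := by
    refine Finset.sum_nbij' (fun η => η \ {e}) (fun η => insert e η) ?_ ?_ ?_ ?_ ?_
    · intro η hη; simp only [Finset.mem_filter, Finset.mem_univ, true_and, Set.mem_sdiff, Set.mem_singleton_iff,
        not_true_eq_false, and_false, not_false_eq_true]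
    · intro η hη; simp only [Finset.mem_filter, Finset.mem_univ, true_and, Set.mem_insert_iff, true_or]
    · intro η hη; simp only [Set.insert_sdiff_singleton, Set.insert_eq_of_mem (Finset.mem_filter.1 hη).2]
    · intro η hη
      show insert e η \ {e} = η
      rw [← Set.union_singleton, Set.union_sdiff_right, Set.sdiff_singleton_eq_self (Finset.mem_filter.1 hη).2]
    · intro η hη
      have he : e ∈ η := (Finset.mem_filter.1 hη).2
      simp only [if_pos he, one_mul, Set.insert_sdiff_singleton, Set.insert_eq_of_mem he]
  rw [hreidx, hzeroL, hzeroR, add_zero, zero_add]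
  refine Finset.sum_congr rfl fun η hη => ?_
  have he : e ∉ η := (Finset.mem_filter.1 hη).2
  rw [hfac (insert e η), hfac₀ η, hRins η, if_pos (Set.mem_insert e η), if_neg he]
  ring

/-- **Pinning one coordinate CLOSED**: `Σ_η weight(w) η · 1{e ∉ η} · φ(η) = (1 − w e) · Σ_η weight(w₀) η · φ η`. [folklore] -/
theorem sum_weight_indicator_not_mem_mul (w : ι → ℝ) (e : ι) (φ : Set ι → ℝ) :
    ∑ η, weight w η * ((if e ∈ η then (0 : ℝ) else 1) * φ η) =
      (1 - w e) * ∑ η, weight (fun i => if i = e then 0 else w i) η * φ η := by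
  classical
  have h1 : ∀ η : Set ι, weight w η * ((if e ∈ η then (0 : ℝ) else 1) * φ η) =
      weight w η * φ (η \ {e}) - weight w η * ((if e ∈ η then (1 : ℝ) else 0) * φ (η \ {e})) := by
    intro η
    by_cases he : e ∈ η
    · rw [if_pos he, if_pos he]; ring
    · rw [if_neg he, if_neg he, Set.sdiff_singleton_eq_self he]; ring
  simp_rw [h1]
  rw [Finset.sum_sub_distrib, HullPort.sum_weight_mul_comp_sdiff_singleton w e φ,
    sum_weight_indicator_mul_comp_sdiff_singleton w e φ]
  ring

end Weights

section Graph

variable {V : Type*}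

/-- The pair `{x, v}` (`x ≠ v`) belongs to the open edge cluster of `x` iff it is open. [folklore] -/
theorem pair_mem_openEdgeCluster_iff {ω : BondConfig V} {x v : V} (hxv : x ≠ v) :
    s(x, v) ∈ openEdgeCluster ω x ↔ s(x, v) ∈ ω := by
  rw [mem_openEdgeCluster_iff]
  constructor
  · exact fun h => h.1
  · intro h
    refine ⟨h, ?_, ?_⟩
    · rw [Sym2.mk_isDiag_iff]; exact hxv
    · intro u hu
      rcases Sym2.mem_iff.1 hu with rfl | rfl
      · exact SimpleGraph.Reachable.refl _
      · exact SimpleGraph.Adj.reachable ((openGraph_adj ω _ _).2 ⟨h, hxv⟩)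

/-- With the pair `e = {x, v}` open, `x ↔ u` iff `x ↔ u` or `v ↔ u` after deleting `e`. [folklore] -/
theorem reachable_iff_sdiff_pair {ω : BondConfig V} {x v : V} (u : V) (he : s(x, v) ∈ ω) :
    (openGraph ω).Reachable x u ↔
      (openGraph (ω \ {s(x, v)})).Reachable x u ∨ (openGraph (ω \ {s(x, v)})).Reachable v u := by
  have hins : insert s(x, v) (ω \ {s(x, v)}) = ω := by
    rw [Set.insert_sdiff_singleton, Set.insert_eq_of_mem he]
  have key := KNSep.reachable_insert_iff (ω \ {s(x, v)}) x v x u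
  rw [hins] at key; rw [key]
  constructor
  · rintro (h | ⟨-, h⟩ | ⟨-, h⟩)
    · exact Or.inl h
    · exact Or.inr h
    · exact Or.inl h
  · rintro (h | h)
    · exact Or.inl h
    · exact Or.inr (Or.inl ⟨SimpleGraph.Reachable.refl _, h⟩)

/-- The level-0 conditioning set of the hierarchy with empty avoided set: `{x ↮ ∅} = univ`. [folklore] -/
theorem setOf_avoid_empty_eq_univ (x : V) :
    {ω : BondConfig V | ∀ y ∈ (∅ : Set V), ¬ (openGraph ω).Reachable x y} = Set.univ := by
  ext ω; simp

/-- The level-0 observer set with no avoided vertices and no decoys: `{v ↮ {x} ∪ ∅} = {v ↮ x}`. [folklore] -/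
theorem setOf_avoid_insert_nil_eq (x v : V) :
    {ω : BondConfig V | ∀ a ∈ insert x (∅ : Set V) ∪ {d | d ∈ ([] : List V)}, ¬ (openGraph ω).Reachable v a} =
      {ω | ¬ (openGraph ω).Reachable v x} := by
  ext ω; simp

end Graph

variable {V : Type*} [Fintype V]

/-- **Pinning one pair OPEN, integral form**: `∫ 1{e ∈ ω} φ(ω ∖ {e}) dμ_w = w_e · ∫ φ dμ_{w₀}`. [folklore] -/
theorem integral_indicator_mem_mul_comp_sdiff (w : Sym2 V → unitInterval) (e : Sym2 V) (φ : BondConfig V → ℝ) :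
    ∫ ω, (if e ∈ ω then (1 : ℝ) else 0) * φ (ω \ {e}) ∂(prodBernoulli w) =
      (w e : ℝ) * ∫ ω, φ ω ∂(prodBernoulli fun d => if d = e then 0 else w d) := by
  classical
  rw [integral_prodBernoulli_eq_sum w (fun ω => (if e ∈ ω then (1 : ℝ) else 0) * φ (ω \ {e})),
    integral_prodBernoulli_eq_sum, sum_weight_indicator_mul_comp_sdiff_singleton (fun d => (w d : ℝ)) e φ]
  congr 1
  refine Finset.sum_congr rfl fun η _ => ?_
  congr 2
  funext d
  split_ifs <;> rfl

/-- **Pinning one pair CLOSED, integral form**: `∫ 1{e ∉ ω} φ(ω) dμ_w = (1 − w_e) · ∫ φ dμ_{w₀}`. [folklore] -/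
theorem integral_indicator_not_mem_mul (w : Sym2 V → unitInterval) (e : Sym2 V) (φ : BondConfig V → ℝ) :
    ∫ ω, (if e ∈ ω then (0 : ℝ) else 1) * φ ω ∂(prodBernoulli w) =
      (1 - (w e : ℝ)) * ∫ ω, φ ω ∂(prodBernoulli fun d => if d = e then 0 else w d) := by
  classical
  rw [integral_prodBernoulli_eq_sum w (fun ω => (if e ∈ ω then (0 : ℝ) else 1) * φ ω),
    integral_prodBernoulli_eq_sum, sum_weight_indicator_not_mem_mul (fun d => (w d : ℝ)) e φ]
  congr 1
  refine Finset.sum_congr rfl fun η _ => ?_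
  congr 2
  funext d
  split_ifs <;> rfl

/-- **The two level-0 covariances at the pair functional, in closed form.**  With `e = s(x,v)`, `x ≠ v`, `μ = prodBernoulli w`,
`μ₀` the same law with `e` switched off, and `f = 1{e ∈ ·}`:
`∫_{x↔u} f(𝐂_x) dμ = w_e · μ₀(x ↔ u ∨ v ↔ u)`, `∫ f(𝐂_x) dμ = w_e`, `μ(x ↔ u) = w_e μ₀(x ↔ u ∨ v ↔ u) + (1 − w_e) μ₀(x ↔ u)`,
whence `covD w x ∅ f u = w_e (1 − w_e) (μ₀(x ↔ u ∨ v ↔ u) − μ₀(x ↔ u))`. [folklore] -/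
theorem covD_nil_pairOpen_eq (w : Sym2 V → unitInterval) (x v u : V) (hxv : x ≠ v) :
    covD w x ∅ (fun C => if s(x, v) ∈ C then (1 : ℝ) else 0) u =
      (w s(x, v) : ℝ) * (1 - w s(x, v)) *
        ((prodBernoulli fun d => if d = s(x, v) then 0 else w d).real (openConn x u ∪ openConn v u) -
          (prodBernoulli fun d => if d = s(x, v) then 0 else w d).real (openConn x u)) := by
  classical
  set e : Sym2 V := s(x, v) with he_def
  set μ := prodBernoulli w with hμ
  set μ₀ := prodBernoulli (fun d => if d = e then 0 else w d) with hμ₀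
  have hmeas : ∀ T : Set (BondConfig V), MeasurableSet T := fun _ => MeasurableSet.of_discrete
  set gB : BondConfig V → ℝ := (openConn x u ∪ openConn v u).indicator 1 with hgB
  set gA : BondConfig V → ℝ := (openConn x u).indicator 1 with hgA
  set g1 : BondConfig V → ℝ := fun _ => 1 with hg1
  -- the functional read on configurations
  have hf : ∀ ω : BondConfig V, (fun C : Set (Sym2 V) => if s(x, v) ∈ C then (1 : ℝ) else 0) (openEdgeCluster ω x) =
      if e ∈ ω then 1 else 0 := by
    intro ω
    simp only [he_def, pair_mem_openEdgeCluster_iff hxv]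
  -- on `{e ∈ ω}`, `x ↔ u` is read off `ω ∖ {e}` as `x ↔ u ∨ v ↔ u`
  have hiff : ∀ ω : BondConfig V, e ∈ ω → (ω ∈ openConn x u ↔ ω \ {e} ∈ openConn x u ∪ openConn v u) := by
    intro ω heω
    show (openGraph ω).Reachable x u ↔ _
    rw [reachable_iff_sdiff_pair u heω]
    rfl
  have hgB1 : ∀ ζ, ζ ∈ openConn x u ∪ openConn v u → gB ζ = 1 := fun ζ h => by rw [hgB, Set.indicator_of_mem h, Pi.one_apply]
  have hgB0 : ∀ ζ, ζ ∉ openConn x u ∪ openConn v u → gB ζ = 0 := fun ζ h => by rw [hgB, Set.indicator_of_notMem h]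
  have hgA1 : ∀ ζ, ζ ∈ openConn x u → gA ζ = 1 := fun ζ h => by rw [hgA, Set.indicator_of_mem h, Pi.one_apply]
  have hgA0 : ∀ ζ, ζ ∉ openConn x u → gA ζ = 0 := fun ζ h => by rw [hgA, Set.indicator_of_notMem h]
  -- (1) the restricted integral
  have h1 : ∫ ω in openConn x u, (fun C : Set (Sym2 V) => if s(x, v) ∈ C then (1 : ℝ) else 0) (openEdgeCluster ω x) ∂μ =
      (w e : ℝ) * μ₀.real (openConn x u ∪ openConn v u) := by
    rw [← integral_indicator (hmeas _)]
    have hpt : ∀ ω : BondConfig V,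
        (openConn x u).indicator (fun ω => (fun C : Set (Sym2 V) => if s(x, v) ∈ C then (1 : ℝ) else 0) (openEdgeCluster ω x)) ω =
          (if e ∈ ω then (1 : ℝ) else 0) * gB (ω \ {e}) := by
      intro ω
      by_cases heω : e ∈ ω
      · by_cases hA : ω ∈ openConn x u
        · rw [Set.indicator_of_mem hA, hf, if_pos heω, hgB1 _ ((hiff ω heω).1 hA)]; ring
        · rw [Set.indicator_of_notMem hA, hgB0 _ (fun h => hA ((hiff ω heω).2 h))]; ring
      · by_cases hA : ω ∈ openConn x u
        · rw [Set.indicator_of_mem hA, hf, if_neg heω]; ring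
        · rw [Set.indicator_of_notMem hA, if_neg heω]; ring
    simp_rw [hpt]
    rw [integral_indicator_mem_mul_comp_sdiff, hgB, integral_indicator_one (hmeas _)]
  -- (2) the plain integral
  have h2 : ∫ ω, (fun C : Set (Sym2 V) => if s(x, v) ∈ C then (1 : ℝ) else 0) (openEdgeCluster ω x) ∂μ = (w e : ℝ) := by
    have hpt : ∀ ω : BondConfig V, (fun C : Set (Sym2 V) => if s(x, v) ∈ C then (1 : ℝ) else 0) (openEdgeCluster ω x) =
        (if e ∈ ω then (1 : ℝ) else 0) * g1 (ω \ {e}) := by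
      intro ω; rw [hf, hg1]; ring
    simp_rw [hpt]
    rw [integral_indicator_mem_mul_comp_sdiff, hg1, integral_const, smul_eq_mul, probReal_univ]
    ring
  -- (3) the connection probability
  have h3 : μ.real (openConn x u) = (w e : ℝ) * μ₀.real (openConn x u ∪ openConn v u) +
      (1 - (w e : ℝ)) * μ₀.real (openConn x u) := by
    rw [← integral_indicator_one (hmeas _)]
    have hpt : ∀ ω : BondConfig V, (openConn x u).indicator (1 : BondConfig V → ℝ) ω =
        (if e ∈ ω then (1 : ℝ) else 0) * gB (ω \ {e}) + (if e ∈ ω then (0 : ℝ) else 1) * gA ω := by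
      intro ω
      by_cases heω : e ∈ ω
      · by_cases hA : ω ∈ openConn x u
        · rw [Set.indicator_of_mem hA, Pi.one_apply, hgB1 _ ((hiff ω heω).1 hA), hgA1 _ hA, if_pos heω, if_pos heω]; ring
        · rw [Set.indicator_of_notMem hA, hgB0 _ (fun h => hA ((hiff ω heω).2 h)), hgA0 _ hA]; ring
      · by_cases hA : ω ∈ openConn x u
        · rw [Set.indicator_of_mem hA, Pi.one_apply, hgA1 _ hA, if_neg heω, if_neg heω]; ring
        · rw [Set.indicator_of_notMem hA, hgA0 _ hA, if_neg heω]; ring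
    simp_rw [hpt]
    rw [integral_add (Integrable.of_finite) (Integrable.of_finite), integral_indicator_mem_mul_comp_sdiff,
      integral_indicator_not_mem_mul, hgB, hgA, integral_indicator_one (hmeas _), integral_indicator_one (hmeas _)]
  -- assemble
  unfold covD
  rw [setOf_avoid_empty_eq_univ, Set.univ_inter, Measure.restrict_univ, probReal_univ, h1, h2, h3]
  ring

/-- At the second observer itself: `covD(f, v) = w_e (1 − w_e) · μ₀(v ↮ x)` (`f = 1{s(x,v) ∈ ·}`, `μ₀` = law with `e` off). [folklore] -/
theorem covD_nil_pairOpen_self (w : Sym2 V → unitInterval) (x v : V) (hxv : x ≠ v) :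
    covD w x ∅ (fun C => if s(x, v) ∈ C then (1 : ℝ) else 0) v =
      (w s(x, v) : ℝ) * (1 - w s(x, v)) *
        (prodBernoulli fun d => if d = s(x, v) then 0 else w d).real {ω | ¬ (openGraph ω).Reachable v x} := by
  have hmeas : ∀ T : Set (BondConfig V), MeasurableSet T := fun _ => MeasurableSet.of_discrete
  rw [covD_nil_pairOpen_eq w x v v hxv]
  have hB : (openConn x v ∪ openConn v v : Set (BondConfig V)) = Set.univ := by
    ext ω
    simp only [Set.mem_union, Set.mem_univ, iff_true]
    exact Or.inr (SimpleGraph.Reachable.refl _)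
  have hA : (openConn x v : Set (BondConfig V)) = {ω | ¬ (openGraph ω).Reachable v x}ᶜ := by
    ext ω
    simp only [Set.mem_compl_iff, Set.mem_setOf_eq, not_not]
    exact ⟨SimpleGraph.Reachable.symm, SimpleGraph.Reachable.symm⟩
  rw [hB, probReal_univ, hA, probReal_compl_eq_one_sub (hmeas _)]
  ring

/-- **The observer constant is attained (level 0, empty avoided set).**  For every finite weighted graph and `x ≠ v`, the
level-0 margin of the conditioned slack hierarchy vanishes at `f = 1{s(x,v) ∈ 𝐂_x}`:
`Cov(f, 1{x ↔ o}) − P(o ∈ C_v | v ↮ x) · Cov(f, 1{x ↔ v}) = 0`. [folklore] -/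
theorem cshMargin_nil_pairOpen_eq_zero (w : Sym2 V → unitInterval) (x o v : V) (hxv : x ≠ v) :
    cshMargin w x ∅ [] o v (fun C => if s(x, v) ∈ C then (1 : ℝ) else 0) = 0 := by
  classical
  set e : Sym2 V := s(x, v) with he_def
  set μ := prodBernoulli w with hμ
  set μ₀ := prodBernoulli (fun d => if d = e then 0 else w d) with hμ₀
  have hmeas : ∀ T : Set (BondConfig V), MeasurableSet T := fun _ => MeasurableSet.of_discrete
  -- unfold the margin to `covD o − p · covD v`
  show cshMarg (decoyList w (insert x (∅ : Set V)) ([] : List V))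
      (obsConst w o v (insert x (∅ : Set V) ∪ {d | d ∈ ([] : List V)})) o v
      (covD w x ∅ (fun C => if s(x, v) ∈ C then (1 : ℝ) else 0)) = 0
  rw [show decoyList w (insert x (∅ : Set V)) ([] : List V) = [] from rfl, cshMarg_nil]
  unfold obsConst
  rw [setOf_avoid_insert_nil_eq, covD_nil_pairOpen_eq w x v o hxv, covD_nil_pairOpen_self w x v hxv]
  -- the observer's sets only see configurations with `e` closed
  set M : Set (BondConfig V) := {ω | ¬ (openGraph ω).Reachable v x} with hM
  have hclosed : ∀ S : Set (BondConfig V), μ.real (M ∩ S) = (1 - (w e : ℝ)) * μ₀.real (M ∩ S) := by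
    intro S
    rw [← integral_indicator_one (hmeas _), ← integral_indicator_one (hmeas _)]
    set gS : BondConfig V → ℝ := (M ∩ S).indicator 1 with hgS
    have hpt : ∀ ω : BondConfig V, gS ω = (if e ∈ ω then (0 : ℝ) else 1) * gS ω := by
      intro ω
      by_cases heω : e ∈ ω
      · have hvx : (openGraph ω).Reachable v x :=
          SimpleGraph.Adj.reachable ((openGraph_adj ω _ _).2 ⟨by rw [Sym2.eq_swap]; exact heω, hxv.symm⟩)
        have hnot : ω ∉ M ∩ S := fun h => h.1 hvx
        rw [hgS, Set.indicator_of_notMem hnot]; ring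
      · rw [if_neg heω]; ring
    have hint : ∫ ω, gS ω ∂μ = ∫ ω, (if e ∈ ω then (0 : ℝ) else 1) * gS ω ∂μ :=
      integral_congr_ae (Filter.Eventually.of_forall hpt)
    rw [hint, integral_indicator_not_mem_mul]
  -- identify the μ₀-quantity at the first observer
  have hBo : μ₀.real (openConn x o ∪ openConn v o) - μ₀.real (openConn x o) = μ₀.real (M ∩ openConn o v) := by
    have hdisj : Disjoint (openConn x o : Set (BondConfig V)) (M ∩ openConn o v) := by
      rw [Set.disjoint_left]
      intro ω hxo hMo
      exact hMo.1 (hMo.2.symm.trans hxo.symm)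
    have hunion : (openConn x o ∪ openConn v o : Set (BondConfig V)) = openConn x o ∪ (M ∩ openConn o v) := by
      ext ω
      simp only [Set.mem_union, Set.mem_inter_iff, hM, Set.mem_setOf_eq]
      constructor
      · rintro (h | h)
        · exact Or.inl h
        · by_cases hxo : ω ∈ openConn x o
          · exact Or.inl hxo
          · refine Or.inr ⟨fun hvx => hxo ?_, SimpleGraph.Reachable.symm h⟩
            exact hvx.symm.trans h
      · rintro (h | ⟨-, h⟩)
        · exact Or.inl h
        · exact Or.inr (SimpleGraph.Reachable.symm h)
    rw [hunion, measureReal_union hdisj (hmeas _)]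
    ring
  have hN : μ.real (M ∩ openConn o v) = (1 - (w e : ℝ)) * μ₀.real (M ∩ openConn o v) := hclosed _
  have hMM : μ.real M = (1 - (w e : ℝ)) * μ₀.real M := by
    have := hclosed Set.univ
    rwa [Set.inter_univ] at this
  rw [hN, hMM, hBo]
  -- algebra, with the degenerate cases `w_e = 1` and `μ₀(M) = 0`
  by_cases hw1 : (1 - (w e : ℝ)) = 0
  · rw [hw1]; ring
  by_cases hM0 : μ₀.real M = 0
  · have hN0 : μ₀.real (M ∩ openConn o v) = 0 :=
      le_antisymm (le_trans (measureReal_mono Set.inter_subset_left) hM0.le) measureReal_nonneg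
    rw [hM0, hN0]; ring
  field_simp
  ring

/-- **No larger observer constant (level 0, empty avoided set, non-degenerate weights).**  If all pair weights lie in `(0,1)`, then
for every `p' > P(o ∈ C_v | v ↮ x)` the level-0 inequality fails at `f = 1{s(x,v) ∈ 𝐂_x}`:
`covD(f, o) − p' · covD(f, v) < 0`.  So the observer constant of `CSH.cshMargin_nil_nonneg` / `CovTau.markerDominanceAvoid`
(`Y = ∅`) cannot be replaced by any larger function of the same data. [folklore] -/
theorem obsConst_nil_not_improvable (w : Sym2 V → unitInterval) (hw : ∀ e, 0 < w e ∧ w e < 1) (x o v : V) (hxv : x ≠ v)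
    (p' : ℝ) (hp' : obsConst w o v (insert x (∅ : Set V) ∪ {d | d ∈ ([] : List V)}) < p') :
    covD w x ∅ (fun C => if s(x, v) ∈ C then (1 : ℝ) else 0) o -
        p' * covD w x ∅ (fun C => if s(x, v) ∈ C then (1 : ℝ) else 0) v < 0 := by
  classical
  have h0 : covD w x ∅ (fun C => if s(x, v) ∈ C then (1 : ℝ) else 0) o -
      obsConst w o v (insert x (∅ : Set V) ∪ {d | d ∈ ([] : List V)}) *
        covD w x ∅ (fun C => if s(x, v) ∈ C then (1 : ℝ) else 0) v = 0 := by
    have h := cshMargin_nil_pairOpen_eq_zero w x o v hxv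
    have hunf : cshMargin w x ∅ [] o v (fun C => if s(x, v) ∈ C then (1 : ℝ) else 0) =
        cshMarg (decoyList w (insert x (∅ : Set V)) ([] : List V))
          (obsConst w o v (insert x (∅ : Set V) ∪ {d | d ∈ ([] : List V)})) o v
          (covD w x ∅ (fun C => if s(x, v) ∈ C then (1 : ℝ) else 0)) := rfl
    rw [hunf, show decoyList w (insert x (∅ : Set V)) ([] : List V) = [] from rfl, cshMarg_nil] at h
    exact h
  -- the `v`-covariance is strictly positive: the all-closed configuration avoids `v ↔ x`
  have hpos : 0 < covD w x ∅ (fun C => if s(x, v) ∈ C then (1 : ℝ) else 0) v := by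
    rw [covD_nil_pairOpen_self w x v hxv]
    have h1' : (0 : ℝ) < w s(x, v) := by exact_mod_cast (hw s(x, v)).1
    have h2' : (w s(x, v) : ℝ) < 1 := by exact_mod_cast (hw s(x, v)).2
    refine mul_pos (mul_pos h1' (by linarith)) (prodBernoulli_real_pos_of_empty_mem _ (fun d => ?_) ?_)
    · show (if d = s(x, v) then (0 : unitInterval) else w d) < 1
      split_ifs
      · exact zero_lt_one
      · exact (hw d).2
    · show ¬ (openGraph (∅ : BondConfig V)).Reachable v x
      intro h
      rw [SimpleGraph.reachable_iff_reflTransGen] at h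
      rcases Relation.ReflTransGen.cases_head h with hvx' | ⟨z, hadj, -⟩
      · exact hxv hvx'.symm
      · exact ((openGraph_adj _ _ _).1 hadj).1
  nlinarith [h0, hpos, hp']

end CSH

end Summit.CriticalPhenomena.PercolationContinuityZ3.Theorems

end
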